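import Summits.QuantumFields.QCD.Theorems.SpectralDefectExtinctionWegnerEstimateStubCoareaWegnerHolder
import Summits.QuantumFields.QCD.Theorems.SpectralDefectExtinctionWegnerEstimateHolderReduction
import Summits.QuantumFields.QCD.Theorems.SpectralDefectExtinctionWegnerEstimateSketchDefs
import Summits.QuantumFields.QCD.Theorems.SpectralDefectExtinctionWegnerEstimateStubCircleZeroCount
import Summits.QuantumFields.QCD.Theorems.SpectralDefectExtinctionWegnerEstimateStubResolventLocalSpectralSum

/-!
# The HÖLDER BRANCH of line `Sketch` (skeleton "ResolventCell", gen 2c) for crux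
`SpectralDefectExtinction.WegnerEstimate` (item stmt-QuantumFields-8966) — COMPOSITION

The gen-2c skeleton reduces the crux to three stubs over the junk-free port functional `badPort R`
(`Theorems/SpectralDefectExtinctionWegnerEstimateSketchDefs.lean`): `stub_portContinuous`, `stub_portRigidity`
(bookkeeping) and `stub_portSmallBall` (the bet: a saturated Haar small-ball estimate with exponent `m > 1`).
The LINEAR Wegner estimate needs `m > 1 = k`; this file records that ANY POSITIVE small-ball exponent already
gives the HÖLDER Wegner estimate the planners declared sufficient for the route (`wegnerEstimate_imp_holder`,
`Theorems/WegnerEstimate/Negative/LoadBearing.lean`):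

`wegnerEstimateHolder_of_portSmallBallWeak` — from the verbatim statements of `stub_portContinuous` and
`stub_portRigidity` (hypotheses) and the WEAK small ball (`stub_portSmallBall` with `1 < m` replaced by `0 < m`),
the Hölder crux statement `E N_ε ≤ C (1 + β^p) ε^α L⁴` with `α = m/(m+1) ∈ (0,1]`, via the landed
`stub_circleZeroCount` (p134960), `stub_resolventLocalSpectralSum` (p135064), the Hölder 1-D route
`stub_coareaWegnerHolder` and the Hölder reduction `wegnerEstimateHolder_of_localHaarWegnerHolder`.
-/

noncomputable section

namespace Summit.QuantumFields.QCD.Cruxes.WegnerEstimate.ResolventCell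

open MeasureTheory
open scoped Matrix BigOperators
open Literature.MathematicalPhysics.QuantumLattice Literature.MathematicalPhysics.QuantumFieldTheory
  Literature.Probability.LatticeModels
open Matrix
open scoped ComplexOrder

/-- **The Hölder Wegner estimate from a WEAK port small-ball estimate.**  IF `badPort R` is continuous and
non-negative for every `R` (`stub_portContinuous`, verbatim), near-zero modes obey the port rigidity inequality
(`stub_portRigidity`, verbatim), and for SOME cube radius `R` the saturated small balls of `badPort R` have product-Haar
measure `≤ C_B δ^m` with SOME `m > 0` (`stub_portSmallBall` with `1 < m` weakened to `0 < m`), THEN the Hölder Wegner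
estimate holds: `E N_ε ≤ C (1 + β^p) ε^α L⁴` for some `C > 0`, `p ≥ 0`, `α ∈ (0,1]` (in fact `α = m/(m+1)`). -/
theorem wegnerEstimateHolder_of_portSmallBallWeak
    (hcont : ∀ R : ℕ, Continuous (badPort R) ∧ ∀ w, 0 ≤ badPort R w)
    (hrig : ∀ (R : ℕ) (L : ℕ) [NeZero L], 2 ≤ L → ∀ (x : TorusSite 4 L) (m₀ : ℝ), -1 ≤ m₀ → m₀ ≤ 0 →
      ∀ (U V : GaugeConfig 4 L SU3) (ψ : QuarkIdx L → ℂ) (lam : ℝ), |lam| ≤ 1 →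
      (spinorLift gammaFive * wilsonDirac (fundamentalRep (Fin 3))
          (fun e => if (∃ y ∈ box 4 R, e.1 = x + Torus.proj L y) then V e else U e) m₀ 1).mulVec ψ =
        (lam : ℂ) • ψ →
      badPort R (fun l => (fun e : Edge 4 L => if (∃ y ∈ box 4 R, e.1 = x + Torus.proj L y) then V e else U e)
          (x + Torus.proj L l.1, l.2)) *
          boxMass ψ ((box 4 (R - 1)).image fun y => x + Torus.proj L y) ≤
        ∑ y ∈ box 4 R, ∑ μ : Fin 4, ∑ i : Fin 8,
                |2 * (∑ a : Fin 3, ∑ b : Fin 3, ∑ α : Fin 4, ∑ β : Fin 4,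
                    star (ψ (x + Torus.proj L y, a, α)) *
                      (gammaFive * ((-(1 / 2 : ℂ)) • ((1 : Matrix (Fin 4) (Fin 4) ℂ) - euclideanGamma μ))) α β *
                      ((((fun e : Edge 4 L => if (∃ y ∈ box 4 R, e.1 = x + Torus.proj L y) then V e else U e)
                            (x + Torus.proj L y, μ) : SU3) : Matrix (Fin 3) (Fin 3) ℂ) *
                          (![!![0, 1, 0; -1, 0, 0; 0, 0, 0], !![0, 0, 1; 0, 0, 0; -1, 0, 0],
                             !![0, 0, 0; 0, 0, 1; 0, -1, 0], !![0, Complex.I, 0; Complex.I, 0, 0; 0, 0, 0],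
                             !![0, 0, Complex.I; 0, 0, 0; Complex.I, 0, 0],
                             !![0, 0, 0; 0, 0, Complex.I; 0, Complex.I, 0],
                             !![Complex.I, 0, 0; 0, -Complex.I, 0; 0, 0, 0],
                             !![0, 0, 0; 0, Complex.I, 0; 0, 0, -Complex.I]] i : Matrix (Fin 3) (Fin 3) ℂ)) a b *
                      ψ (Literature.MathematicalPhysics.QuantumFieldTheory.Site.shift (x + Torus.proj L y) μ,
                        b, β)).re|)
    (hsmallWeak : ∃ (R : ℕ) (m C_B : ℝ), 0 < m ∧ 0 < C_B ∧
      ∀ (L : ℕ) [NeZero L], 2 ≤ L → ∀ (x : TorusSite 4 L) (U : GaugeConfig 4 L SU3) (e₀ : Edge 4 L) (δ : ℝ),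
        0 < δ → δ ≤ 1 →
        (Measure.pi fun _ : Edge 4 L => haarProbability SU3)
            {V : GaugeConfig 4 L SU3 | ∃ g : SU3,
              badPort R (fun l => (fun e : Edge 4 L => if (∃ y ∈ box 4 R, e.1 = x + Torus.proj L y) then
                  Function.update V e₀ g e else U e) (x + Torus.proj L l.1, l.2)) < δ} ≤
          ENNReal.ofReal (C_B * δ ^ m)) :
    ∃ C p α : ℝ, 0 < C ∧ 0 ≤ p ∧ 0 < α ∧ α ≤ 1 ∧ ∀ β : ℝ, 1 ≤ β → ∀ (L : ℕ) [NeZero L], 2 ≤ L →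
      ∀ m₀ ε : ℝ, -1 ≤ m₀ → m₀ ≤ 0 → 0 < ε → ε ≤ 1 →
        ∫ U, (Multiset.countP (fun z : ℂ => |z.re| < ε) (spinorLift gammaFive * wilsonDirac (fundamentalRep (Fin 3)) U m₀ 1).charpoly.roots : ℝ) ∂(wilsonMeasure (d := 4) (L := L) (fundamentalRep (Fin 3)) β) ≤ C * (1 + β ^ p) * ε ^ α * (L : ℝ) ^ 4 := by
  refine wegnerEstimateHolder_of_localHaarWegnerHolder
    (stub_coareaWegnerHolder stub_circleZeroCount stub_resolventLocalSpectralSum ?_)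
  -- the weak rigidity data, derived as `stub_currentRigidity` in the skeleton (`R' = R − 1`, `k = c₀ = 1`)
  obtain ⟨R, m, C_B, hm, hCB, hsb⟩ := hsmallWeak
  refine ⟨R, R - 1, 1, m, 1, C_B, Nat.sub_le R 1, hm, one_pos, hCB, badPort R, (hcont R).1, (hcont R).2, hsb, ?_⟩
  intro L _ hL x m₀ hm0 hm0' U V ψ lam hlam hψ
  have h := hrig R L hL x m₀ hm0 hm0' U V ψ lam hlam hψ
  simpa only [one_mul, pow_one] using h

end Summit.QuantumFields.QCD.Cruxes.WegnerEstimate.ResolventCell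

end
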